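import Summits.RiemannHypothesis.RiemannHypothesis.Theorems.S2FormatCTailTwo
import Summits.RiemannHypothesis.RiemannHypothesis.Theorems.S2FormatCFarTwo
import Summits.RiemannHypothesis.RiemannHypothesis.Theorems.S2FormatCCertificateTwo
import Summits.RiemannHypothesis.RiemannHypothesis.Theorems.WeilFormatCDataRung
import HarnessLib

/-!
# Format C at `S = {∞, 2}` — the DATA-ONLY front door: two kernel PSD checks + numeric inequalities ⟹
# `WeilSemilocalPositivityOn {2} b ∧ b ≤ a*({2})`

Seat cc-s2-4 gen4 (`HOME/cc-s2-4/CC4-LEAN.md` §10).  This is the semilocal twin of weil-10's `WeilFormatC.weilPositivityOn_of_formatC_data`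
(`WeilFormatCDataRung.lean`), for the `{∞,2}` kernel `G = S2FormatC.gram b` (`= gramCoeffList b [⟨2,1⟩]`, `S2FormatCGramYoshida`) on the
window `log 2 < 2b`, `b ≤ log 2`.  It composes the whole `{∞,2}` format-C chain — entries + sector split + dictionary + threshold
(`S2FormatC.le_threshold_of_sectorKernels_nonneg`, F12), L-C3a far diagonals `d̂^±₂` with the single-length path-graph constant
`A₂ = Λ·2cos(π/(⌊2b/log 2⌋+2))` (`S2FormatCFarTwo`, F13), L-C3b order 1 (`S2FormatCColumnTwo` / `S2FormatCTailTwo`, F14/F15) and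
weil-10's ∀N soundness `sum_range_mul_mul_nonneg_of_certificate_sum_split` + `columns_majorant` — into ONE theorem whose hypotheses
are exactly what a rung's data files establish by kernel arithmetic:

* `gram_even_dhat_pos_of_pos_at` / `gram_odd_dhat_atan_pos_of_pos_at` — `0 < d̂^±₂` on all far modes from ONE value (weil-10's
  monotone cores `even/odd_dhat_core_mono`, `hilbert_atan_penalty_le`);
* `primeTwo_penalty_eq` — on `log 2 < 2b < 2 log 2` the prime penalty `A₂/2` is `Λ/2` (`⌊2b/log 2⌋ = 1`, `cos(π/3) = ½`);
* **`le_threshold_of_formatC_data`** — `log 2 < 2b ≤ 2 log 2`; EVEN: block `B⁺ ≥ 2`, columns `2B⁺ ≤ B₃⁺`, `θ⁺ > 0`, the numeric facts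
  `0 < d̂⁺₂(B⁺)`, `0 < d₀⁺ ≤ d̂⁺₂(B₃⁺)`, column weights `0 < w⁺_m ≤ d̂⁺₂(m)` on `B⁺ ≤ m < B₃⁺`, and the kernel certificate
  `∀ x, 0 ≤ Σ_{i,j<B⁺} x_i x_j (M⁺(i,j) − Σ_{m∈Ico B⁺ B₃⁺} M⁺(i,m)M⁺(j,m)/w⁺_m − U₂⁺(i,j))` with the explicit order-1 tail matrix `U₂⁺` of
  `gram_even_tail_majorant_matrix` (`Φ₂ = (1 + (4/π)Λ)/4`, `κ⁺₂`); ODD: the same with `B⁻ ≥ 1`, `d̂⁻₂`, `U₂⁻` (`v⁻₂`, `κ⁻₂`), positivity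
  stated for the monotone core minus `π/4`.  Conclusion: `WeilSemilocalPositivityOn {2} b ∧ b ≤ weilSemilocalThreshold {2}`.

No analytic hypothesis is left: every remaining premise is a finite inequality between explicit real constants (`reDigammaQuarter` at
finitely many points, `weilArchDensity (2b)`, `Λ = log 2/√2`, `exp`, `log π`, `√`, `arctan`, `cos(π/(⌊2b/log 2⌋+2))`) or the PSD statement, all
in the scope of weil-2's evaluator (`Yoshida1992.Encl.gramBox` on `gramCoeffList b [⟨2,1⟩]`) + `PsdDyadic.checkPsdMid`.  Standard axioms; no
definitions; no claim about RH (an `S = {2}` rung is a lower bound for the semilocal threshold `a*({2})`, `MotivicDoorSemilocalThreshold`).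
-/

set_option linter.dupNamespace false
set_option autoImplicit false

noncomputable section

open Complex Set Finset Matrix
open scoped Real BigOperators

namespace Summit.RiemannHypothesis.RiemannHypothesis.Theorems.S2FormatC

open Literature.NumberTheory.LFunctions Literature.Analysis.SpecialFunctions
open Literature.NumberTheory.LFunctions.Yoshida1992 (freq polarCoeff incrCoeff archCoeff archExpSumSin)
open Summit.RiemannHypothesis.RiemannHypothesis.Theorems.WeilFormatC
open Summit.RiemannHypothesis.RiemannHypothesis.Theorems.MotivicDoor.SemilocalThreshold

variable {b : ℝ}

/-! ## `0 < d̂^±₂` on all far modes from one value -/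

/-- **`hd` for the even sector of the `{∞,2}` kernel from one value** (`2 ≤ B`): if `0 < d̂⁺₂(B)` then `0 < d̂⁺₂(m)` for every
`m ≥ B` (`d̂⁺₂` of `gram_even_far_ge_diag`). -/
theorem gram_even_dhat_pos_of_pos_at (hb : 0 < b) {B : ℕ} (hB : 2 ≤ B)
    (h0 : 0 < (reDigammaQuarter (freq b B) - Real.log π) / 2
        - b * (1 + weilArchDensity (2 * b)) / (π ^ 2 * B ^ 2)
        - 1 / (8 * B) - b * (1 + weilArchDensity (2 * b)) / π ^ 2 * Real.sqrt (8 / ((B - 1 : ℕ) : ℝ))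
        - lam * (2 * Real.cos (π / (⌊2 * b / Real.log 2⌋₊ + 2))) / 2)
    (m : ℕ) (hm : B ≤ m) :
    0 < (reDigammaQuarter (freq b m) - Real.log π) / 2
        - b * (1 + weilArchDensity (2 * b)) / (π ^ 2 * m ^ 2)
        - 1 / (8 * m) - b * (1 + weilArchDensity (2 * b)) / π ^ 2 * Real.sqrt (8 / ((B - 1 : ℕ) : ℝ))
        - lam * (2 * Real.cos (π / (⌊2 * b / Real.log 2⌋₊ + 2))) / 2 := by
  have hE : 0 < weilArchDensity (2 * b) := weilArchDensity_pos (by positivity)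
  have hC : 0 ≤ b * (1 + weilArchDensity (2 * b)) := by positivity
  have h := even_dhat_core_mono hb hC (le_trans (by norm_num) hB) hm
  linarith

/-- **`hd` for the odd sector of the `{∞,2}` kernel (arctan weights) from one value**: if the monotone core at `k = B` exceeds
`π/4` plus the constants, then `0 < d̂⁻₂(k)` for every `k ≥ B` (`d̂⁻₂` of `gram_odd_far_ge_diag_atan`). -/
theorem gram_odd_dhat_atan_pos_of_pos_at (hb : 0 < b) {B : ℕ}
    (h0 : 0 < (reDigammaQuarter (freq b ((B : ℤ) + 1)) - Real.log π) / 2 - 1 / (8 * ((B : ℝ) + 1))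
        - b * (1 + weilArchDensity (2 * b)) / (π ^ 2 * ((B : ℝ) + 1) ^ 2) - π / 4
        - b * (1 + weilArchDensity (2 * b)) / π ^ 2 * Real.sqrt (8 / B)
        - lam * (2 * Real.cos (π / (⌊2 * b / Real.log 2⌋₊ + 2))) / 2
        - (Real.exp (b / 2) - Real.exp (-(b / 2))) ^ 2 * b / (π ^ 2 * B))
    (k : ℕ) (hk : B ≤ k) :
    0 < (reDigammaQuarter (freq b ((k : ℤ) + 1)) - Real.log π) / 2 - 1 / (8 * ((k : ℝ) + 1))
        - b * (1 + weilArchDensity (2 * b)) / (π ^ 2 * ((k : ℝ) + 1) ^ 2)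
        - (π / 2 - Real.arctan (Real.sqrt B / Real.sqrt ((k : ℝ) + 1))) / 2
        - b * (1 + weilArchDensity (2 * b)) / π ^ 2 * Real.sqrt (8 / B)
        - lam * (2 * Real.cos (π / (⌊2 * b / Real.log 2⌋₊ + 2))) / 2
        - (Real.exp (b / 2) - Real.exp (-(b / 2))) ^ 2 * b / (π ^ 2 * B) := by
  have hE : 0 < weilArchDensity (2 * b) := weilArchDensity_pos (by positivity)
  have hC : 0 ≤ b * (1 + weilArchDensity (2 * b)) := by positivity
  have h := odd_dhat_core_mono hb hC hk
  have hpen := hilbert_atan_penalty_le B k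
  linarith

/-- On the `a*({2})` bracket `log 2 < 2b < 2 log 2` the single-length path-graph constant is `A₂ = Λ·2cos(π/3) = Λ`, so the
prime penalty `A₂/2` in `d̂^±₂` is the rational multiple `Λ/2` of `Λ` (what a data file rewrites with before enclosing). -/
theorem primeTwo_penalty_eq (h2 : Real.log 2 < 2 * b) (h2' : 2 * b < 2 * Real.log 2) :
    lam * (2 * Real.cos (π / (⌊2 * b / Real.log 2⌋₊ + 2))) / 2 = lam / 2 := by
  have hlog : 0 < Real.log 2 := Real.log_pos (by norm_num)
  have hfl : ⌊2 * b / Real.log 2⌋₊ = 1 := by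
    rw [Nat.floor_eq_iff (div_nonneg (by linarith) hlog.le)]
    constructor
    · rw [Nat.cast_one, le_div_iff₀ hlog]; linarith
    · rw [div_lt_iff₀ hlog]; push_cast; linarith
  rw [hfl, Nat.cast_one, show (π / (1 + 2) : ℝ) = π / 3 by norm_num, Real.cos_pi_div_three]
  ring

/-! ## The data-only `{∞,2}` rung theorem -/

section Rung

/-- **Format C at `S = {∞,2}`, data-only front door.**  See the module docstring: every hypothesis is a finite numeric
inequality or a kernel PSD statement about explicit real matrices built from `gram b`; the conclusion is the rung
`WeilSemilocalPositivityOn {2} b ∧ b ≤ weilSemilocalThreshold {2}`.  (Even block: modes `0..B⁺−1`, exact columns `B⁺ ≤ m < B₃⁺`,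
order-1 tail beyond; odd block: kernel indices `0..B⁻−1` = modes `1..B⁻`, exact columns `B⁻ ≤ l < B₃⁻`.) -/
theorem le_threshold_of_formatC_data (hb : 0 < b) (h2 : Real.log 2 < 2 * b) (hb2 : b ≤ Real.log 2)
    -- EVEN sector data
    {Be B3e : ℕ} (hBe : 2 ≤ Be) (hBBe : 2 * Be ≤ B3e) {θe d0e : ℝ} (hθe : 0 < θe) (we : ℕ → ℝ)
    (h0e : 0 < (reDigammaQuarter (freq b Be) - Real.log π) / 2 - b * (1 + weilArchDensity (2 * b)) / (π ^ 2 * Be ^ 2) - 1 / (8 * Be) - b * (1 + weilArchDensity (2 * b)) / π ^ 2 * Real.sqrt (8 / ((Be - 1 : ℕ) : ℝ)) - lam * (2 * Real.cos (π / (⌊2 * b / Real.log 2⌋₊ + 2))) / 2)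
    (hd0e : 0 < d0e ∧ d0e ≤ (reDigammaQuarter (freq b B3e) - Real.log π) / 2 - b * (1 + weilArchDensity (2 * b)) / (π ^ 2 * B3e ^ 2) - 1 / (8 * B3e) - b * (1 + weilArchDensity (2 * b)) / π ^ 2 * Real.sqrt (8 / ((Be - 1 : ℕ) : ℝ)) - lam * (2 * Real.cos (π / (⌊2 * b / Real.log 2⌋₊ + 2))) / 2)
    (hwe : ∀ m, Be ≤ m → m < B3e → 0 < we m ∧ we m ≤ (reDigammaQuarter (freq b m) - Real.log π) / 2 - b * (1 + weilArchDensity (2 * b)) / (π ^ 2 * m ^ 2) - 1 / (8 * m) - b * (1 + weilArchDensity (2 * b)) / π ^ 2 * Real.sqrt (8 / ((Be - 1 : ℕ) : ℝ)) - lam * (2 * Real.cos (π / (⌊2 * b / Real.log 2⌋₊ + 2))) / 2)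
    (hSe : ∀ x : Fin Be → ℝ, 0 ≤ ∑ i, ∑ j, x i * x j *
      ((if (i : ℕ) = 0 then gram b 0 j else if (j : ℕ) = 0 then gram b i 0 else (gram b i j + gram b i (-(j : ℤ))) / 2)
        - (∑ m ∈ Finset.Ico Be B3e, (if (i : ℕ) = 0 then gram b 0 m else if m = 0 then gram b i 0 else (gram b i m + gram b i (-(m : ℤ))) / 2) * (if (j : ℕ) = 0 then gram b 0 m else if m = 0 then gram b j 0 else (gram b j m + gram b j (-(m : ℤ))) / 2) / we m)
        - ((1 + θe) * ((1 + 4 / π * lam) / 4) ^ 2 / (d0e * ((B3e - 1 : ℕ) : ℝ)) * ((-1 : ℝ) ^ (i : ℕ) * (-1 : ℝ) ^ (j : ℕ)) + (if i = j then (1 + θe⁻¹) * (Be / (d0e * ((B3e : ℝ) ^ 2 * ((B3e - 1 : ℕ) : ℝ)))) * ((Real.exp (b / 2) - Real.exp (-(b / 2))) ^ 2 * b / π ^ 2 + 2 * (i : ℕ) * lam / π + (((i : ℕ) : ℝ) / 2 + 8 * b * (1 + weilArchDensity (2 * b)) / (3 * π ^ 2))) ^ 2 else 0))))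
    -- ODD sector data
    {Bo B3o : ℕ} (hBo : 1 ≤ Bo) (hBBo : 2 * Bo ≤ B3o) {θo d0o : ℝ} (hθo : 0 < θo) (wo : ℕ → ℝ)
    (h0o : 0 < (reDigammaQuarter (freq b ((Bo : ℤ) + 1)) - Real.log π) / 2 - 1 / (8 * ((Bo : ℝ) + 1)) - b * (1 + weilArchDensity (2 * b)) / (π ^ 2 * ((Bo : ℝ) + 1) ^ 2) - π / 4 - b * (1 + weilArchDensity (2 * b)) / π ^ 2 * Real.sqrt (8 / Bo) - lam * (2 * Real.cos (π / (⌊2 * b / Real.log 2⌋₊ + 2))) / 2 - (Real.exp (b / 2) - Real.exp (-(b / 2))) ^ 2 * b / (π ^ 2 * Bo))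
    (hd0o : 0 < d0o ∧ d0o ≤ (reDigammaQuarter (freq b ((B3o : ℤ) + 1)) - Real.log π) / 2 - 1 / (8 * ((B3o : ℝ) + 1)) - b * (1 + weilArchDensity (2 * b)) / (π ^ 2 * ((B3o : ℝ) + 1) ^ 2) - π / 4 - b * (1 + weilArchDensity (2 * b)) / π ^ 2 * Real.sqrt (8 / Bo) - lam * (2 * Real.cos (π / (⌊2 * b / Real.log 2⌋₊ + 2))) / 2 - (Real.exp (b / 2) - Real.exp (-(b / 2))) ^ 2 * b / (π ^ 2 * Bo))
    (hwo : ∀ l, Bo ≤ l → l < B3o → 0 < wo l ∧ wo l ≤ (reDigammaQuarter (freq b ((l : ℤ) + 1)) - Real.log π) / 2 - 1 / (8 * ((l : ℝ) + 1)) - b * (1 + weilArchDensity (2 * b)) / (π ^ 2 * ((l : ℝ) + 1) ^ 2) - (π / 2 - Real.arctan (Real.sqrt Bo / Real.sqrt ((l : ℝ) + 1))) / 2 - b * (1 + weilArchDensity (2 * b)) / π ^ 2 * Real.sqrt (8 / Bo) - lam * (2 * Real.cos (π / (⌊2 * b / Real.log 2⌋₊ + 2))) / 2 - (Real.exp (b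 / 2) - Real.exp (-(b / 2))) ^ 2 * b / (π ^ 2 * Bo))
    (hSo : ∀ x : Fin Bo → ℝ, 0 ≤ ∑ k, ∑ k', x k * x k' *
      (((gram b (((k : ℕ) : ℤ) + 1) (((k' : ℕ) : ℤ) + 1) - gram b (((k : ℕ) : ℤ) + 1) (-(((k' : ℕ) : ℤ) + 1))) / 2)
        - (∑ l ∈ Finset.Ico Bo B3o, ((gram b (((k : ℕ) : ℤ) + 1) ((l : ℤ) + 1) - gram b (((k : ℕ) : ℤ) + 1) (-((l : ℤ) + 1))) / 2) * ((gram b (((k' : ℕ) : ℤ) + 1) ((l : ℤ) + 1) - gram b (((k' : ℕ) : ℤ) + 1) (-((l : ℤ) + 1))) / 2) / wo l)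
        - ((1 + θo) * (1 / (d0o * B3o)) * (((-1 : ℝ) ^ ((k : ℕ) + 1) * (-(4 * (Real.exp (b / 2) - Real.exp (-(b / 2))) ^ 2 * (freq b (((k : ℕ) : ℤ) + 1) / (1 + 4 * freq b (((k : ℕ) : ℤ) + 1) ^ 2)) / π) - lam * Real.sin (freq b (((k : ℕ) : ℤ) + 1) * Real.log 2) / π - (Complex.digamma (1 / 4 + ((freq b (((k : ℕ) : ℤ) + 1) : ℝ) : ℂ) / 2 * I)).im / (2 * π) + archExpSumSin b (((k : ℕ) : ℤ) + 1) / π)) * ((-1 : ℝ) ^ ((k' : ℕ) + 1) * (-(4 * (Real.exp (b / 2) - Real.exp (-(b / 2))) ^ 2 * (freq b (((k' : ℕ) : ℤ) + 1) / (1 + 4 * freq b (((k' : ℕ) : ℤ) + 1) ^ 2)) / π) - lam * Real.sin (freq b (((k' : ℕ) : ℤ) + 1) * Real.log 2) / π - (Complex.digamma (1 / 4 + ((freq b (((k' : ℕ) : ℤ) + 1) : ℝ) : ℂ) / 2 * I)).im / (2 * π) + archExpSumSin b (((k' : ℕ) : ℤ) + 1) / π))) + (if k = k' then (1 + θo⁻¹)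 * (Bo / (d0o * ((((B3o : ℝ) + 1) ^ 2) * (B3o : ℝ)))) * ((Real.exp (b / 2) - Real.exp (-(b / 2))) ^ 2 * b ^ 2 / (4 * π ^ 3) + 2 * ((k : ℕ) + 1 : ℕ) * lam / π + ((((k : ℕ) + 1 : ℕ) : ℝ) / 2 + 4 * b * (1 + weilArchDensity (2 * b)) / (3 * π ^ 2))) ^ 2 else 0)))) :
    WeilSemilocalPositivityOn {2} b ∧ b ≤ weilSemilocalThreshold {2} := by
  have hb1 : Real.log 2 ≤ 2 * b := h2.le
  have hE0 : 0 < weilArchDensity (2 * b) := weilArchDensity_pos (by positivity)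
  have hC : 0 ≤ b * (1 + weilArchDensity (2 * b)) := by positivity
  -- the sector kernels and far diagonals as functions
  set Mev : ℕ → ℕ → ℝ := fun i j ↦ (if i = 0 then gram b 0 j else if j = 0 then gram b i 0 else (gram b i j + gram b i (-(j : ℤ))) / 2) with hMev
  set Mod : ℕ → ℕ → ℝ := fun k l ↦ ((gram b ((k : ℤ) + 1) ((l : ℤ) + 1) - gram b ((k : ℤ) + 1) (-((l : ℤ) + 1))) / 2) with hMod
  set dev : ℕ → ℝ := fun m ↦ ((reDigammaQuarter (freq b m) - Real.log π) / 2 - b * (1 + weilArchDensity (2 * b)) / (π ^ 2 * m ^ 2) - 1 / (8 * m) - b * (1 + weilArchDensity (2 * b)) / π ^ 2 * Real.sqrt (8 / ((Be - 1 : ℕ) : ℝ)) - lam * (2 * Real.cos (π / (⌊2 * b / Real.log 2⌋₊ + 2))) / 2) with hdev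
  set dod : ℕ → ℝ := fun l ↦ ((reDigammaQuarter (freq b ((l : ℤ) + 1)) - Real.log π) / 2 - 1 / (8 * ((l : ℝ) + 1)) - b * (1 + weilArchDensity (2 * b)) / (π ^ 2 * ((l : ℝ) + 1) ^ 2) - (π / 2 - Real.arctan (Real.sqrt Bo / Real.sqrt ((l : ℝ) + 1))) / 2 - b * (1 + weilArchDensity (2 * b)) / π ^ 2 * Real.sqrt (8 / Bo) - lam * (2 * Real.cos (π / (⌊2 * b / Real.log 2⌋₊ + 2))) / 2 - (Real.exp (b / 2) - Real.exp (-(b / 2))) ^ 2 * b / (π ^ 2 * Bo)) with hdod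
  refine le_threshold_of_sectorKernels_nonneg hb hb1 hb2 ?_ ?_
  · -- EVEN sector
    intro K y
    have hB3e : 2 ≤ B3e := by omega
    have hB3e1 : 1 ≤ B3e := by omega
    have hd : ∀ m, Be ≤ m → 0 < dev m := fun m hm ↦ by
      simp only [hdev]
      exact gram_even_dhat_pos_of_pos_at hb hBe h0e m hm
    have hdmono : ∀ m, B3e ≤ m → d0e ≤ dev m := fun m hm ↦ by
      simp only [hdev]
      have h := even_dhat_core_mono hb hC hB3e1 hm
      linarith [hd0e.2]
    have hfar : ∀ (N : ℕ) (y : ℕ → ℝ),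
        ∑ n ∈ Finset.Ico Be N, dev n * y n ^ 2 ≤ ∑ n ∈ Finset.Ico Be N, ∑ m ∈ Finset.Ico Be N, y n * Mev n m * y m :=
      fun N y ↦ by
        simp only [hdev, hMev]
        exact gram_even_far_ge_diag hb h2 hBe N y
    have hU1 : ∀ x : Fin Be → ℝ,
        ∑ m ∈ Finset.Ico Be B3e, (∑ i : Fin Be, Mev i m * x i) ^ 2 / dev m
          ≤ x ⬝ᵥ (Matrix.of fun i j : Fin Be ↦ ∑ m ∈ Finset.Ico Be B3e, Mev i m * Mev j m / we m) *ᵥ x :=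
      fun x ↦ columns_majorant (Finset.Ico Be B3e) (fun m i ↦ Mev i m) dev we
        (fun m hm ↦ by
          have hm := Finset.mem_Ico.mp hm
          have h := hwe m hm.1 hm.2
          simp only [hdev]
          exact h) x
    have hU2 := fun (N : ℕ) (x : Fin Be → ℝ) ↦
      gram_even_tail_majorant_matrix hb hBBe hB3e dev hd0e.1 hdmono hθe N x
    have key := sum_range_mul_mul_nonneg_of_certificate_sum_split Mev
      (fun n m ↦ evenKernel_symm (gram b) (gram_symm b) (gram_refl b) n m)
      Be B3e (by omega) dev _ _ hd hfar hU1 (fun N x ↦ by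
        have h := hU2 N x
        simp only [hMev, hdev] at h ⊢
        exact h) (fun x ↦ by
        have h := hSe x
        simp only [hMev, Matrix.of_apply] at h ⊢
        exact h) K y
    simpa only [hMev] using key
  · -- ODD sector
    intro K z
    have hB3o : 1 ≤ B3o := by omega
    have hd : ∀ l, Bo ≤ l → 0 < dod l := fun l hl ↦ by
      simp only [hdod]
      exact gram_odd_dhat_atan_pos_of_pos_at hb h0o l hl
    have hdlow : ∀ l, B3o ≤ l → d0o ≤ dod l := fun l hl ↦ by
      simp only [hdod]
      have h := odd_dhat_core_mono hb hC hl
      have hpen := hilbert_atan_penalty_le Bo l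
      linarith [hd0o.2]
    have hfar : ∀ (N : ℕ) (z : ℕ → ℝ),
        ∑ k ∈ Finset.Ico Bo N, dod k * z k ^ 2 ≤ ∑ k ∈ Finset.Ico Bo N, ∑ l ∈ Finset.Ico Bo N, z k * Mod k l * z l :=
      fun N z ↦ by
        simp only [hdod, hMod]
        exact gram_odd_far_ge_diag_atan hb h2 hBo N z
    have hU1 : ∀ x : Fin Bo → ℝ,
        ∑ l ∈ Finset.Ico Bo B3o, (∑ k : Fin Bo, Mod k l * x k) ^ 2 / dod l
          ≤ x ⬝ᵥ (Matrix.of fun k k' : Fin Bo ↦ ∑ l ∈ Finset.Ico Bo B3o, Mod k l * Mod k' l / wo l) *ᵥ x :=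
      fun x ↦ columns_majorant (Finset.Ico Bo B3o) (fun l k ↦ Mod k l) dod wo
        (fun l hl ↦ by
          have hl := Finset.mem_Ico.mp hl
          have h := hwo l hl.1 hl.2
          simp only [hdod]
          exact h) x
    have hU2 := fun (N : ℕ) (x : Fin Bo → ℝ) ↦
      gram_odd_tail_majorant_matrix hb hBBo hB3o dod hd0o.1 hdlow hθo N x
    have key := sum_range_mul_mul_nonneg_of_certificate_sum_split Mod
      (fun k l ↦ oddKernel_symm (gram b) (gram_symm b) (gram_refl b) k l)
      Bo B3o (by omega) dod _ _ hd hfar hU1 (fun N x ↦ by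
        have h := hU2 N x
        simp only [hMod, hdod] at h ⊢
        exact h) (fun x ↦ by
        have h := hSo x
        simp only [hMod, Matrix.of_apply] at h ⊢
        exact h) K z
    simpa only [hMod] using key

end Rung

end Summit.RiemannHypothesis.RiemannHypothesis.Theorems.S2FormatC

end
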